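import Summits.Parity.GeneralizedHardyLittlewood.Theorems.GreenTaoLevelTwoGITwoCyclicInverseLocalQuadratic

/-!
# Route `GreenTaoLevelTwo`, crux `GITwo` (stmt-Parity-21275), line `birth`, stub `stub_cyclicInverse`:
# C13 assembly, step 6b: the local quadratic correlation with its raw quantitative data exported

Eighty-seventh helper file toward the XL stub `stub_cyclicInverse` (B. Green, T. Tao, *An inverse theorem
for the Gowers `U³(G)` norm*, arXiv:math/0503014, Thm. 68 = PEMS 51 (2008) Thm. 12.8).  Same construction as
`local_quadratic_correlation_core` (`…LocalQuadratic`), re-run with the radii chain and the size bounds kept in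
the conclusion (`ρ ≥ 1/16`, `ρ₂ ≥ κ²ρ/(1600#S)`, `ρ' ≥ (κ⁴/8)ρ₂/(800#S)`, `ρ₄ ≥ m₄/2`, `ρ₅ ≥ ε₅ρ₄/2`,
`#S ≤ 1 + 4/β₀²`, `#F ≤ 128/(κ⁴/8)⁴`, `S' = S ∪ F ∪ c·S ∪ {1}`), so that the constants of arXiv Thm. 68
(`exp(−η^{−C})`) can be made uniform in `N`: every radius is bounded below and `#S'` above by explicit
functions of `ε` and `d ≤ (2²²⁵/ε¹⁶⁸)¹⁷`.

* `local_quadratic_correlation_data`.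

References: [GreenTao2008U3Inverse] arXiv:math/0503014, Thm. 17 (i), §9 and the constants of Thm. 55/68.
-/

noncomputable section

namespace Summit.Parity.GeneralizedHardyLittlewood.GreenTaoLevelTwoGITwoCyclicInverse

open Finset ZMod
open scoped ComplexConjugate
open Literature.NumberTheory.Sieve

variable {M : ℕ} [NeZero M]

/-- **Local quadratic correlation with the raw quantitative data** (the same construction, exporting the
radii chain `ρ ≥ 1/16`, `ρ₂`, `ρ'`, `ρ₄ ≥ m₄/2`, `ρ₅ ≥ ε₅ρ₄/2` and the size bounds `#S`, `#F`, `S' = S ∪ F ∪ c·S ∪ {1}`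
needed to make the constants of Thm. 68 uniform in `N`).
[cite: GreenTao2008U3Inverse, Thm. 17 (i) and §9] -/
theorem local_quadratic_correlation_data (hM : M.Prime) (h2 : 2 < M) {f : ZMod M → ℝ}
    (hf : ∀ x, |f x| ≤ 1) {ε : ℝ} (hε0 : 0 < ε) (hε1 : ε ≤ 1) (hε : ε ≤ gowersPower 3 f) :
    ∃ (d : ℕ) (S F S' : Finset (ZMod M)) (c : ZMod M) (μ : ZMod M → ZMod M) (ρ ρ₂ ρ' ρ₄ ρ₅ : ℝ)
      (x₀ t ζ : ZMod M),
      (S' = S ∪ F ∪ S.image (fun ξ => c * ξ) ∪ {1} ∧ S.Nonempty ∧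
        (#S : ℝ) ≤ 1 + 4 / (ε ^ 17 / 2 ^ 23 / (128 : ℝ) ^ d) ^ 2 ∧
        (#F : ℝ) ≤ 128 / ((ε ^ 17 / 2 ^ 23 / (128 : ℝ) ^ d * Real.sqrt (ε / 2)) ^ 4 / 8) ^ 4 ∧
        1 / 16 ≤ ρ ∧ ρ ≤ 1 / 8 ∧
        (ε ^ 17 / 2 ^ 23 / (128 : ℝ) ^ d * Real.sqrt (ε / 2)) ^ 2 * ρ / (1600 * (#S : ℝ)) ≤ ρ₂ ∧
        ((ε ^ 17 / 2 ^ 23 / (128 : ℝ) ^ d * Real.sqrt (ε / 2)) ^ 4 / 8) / (800 * (#S : ℝ)) * ρ₂ ≤ ρ' ∧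
        min (1 / 12) (min (((ε ^ 17 / 2 ^ 23 / (128 : ℝ) ^ d * Real.sqrt (ε / 2)) ^ 4 / 8) ^ 8 /
            (2 ^ 32 * (#S : ℝ)) * ρ')
          (min (min (1 / (100 * (#S : ℝ))) ((ε ^ 17 / 2 ^ 23 / (128 : ℝ) ^ d * Real.sqrt (ε / 2)) /
            (400 * (#S : ℝ))) * ρ)
            ((ε ^ 17 / 2 ^ 23 / (128 : ℝ) ^ d * Real.sqrt (ε / 2)) * ρ₂ *
              ((ε ^ 17 / 2 ^ 23 / (128 : ℝ) ^ d * Real.sqrt (ε / 2)) ^ 4 / 8) ^ 2 /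
              (2 ^ 19 * Real.pi * (#S : ℝ))))) / 2 ≤ ρ₄ ∧
        min (1 / (100 * (#S' : ℝ))) ((ε ^ 17 / 2 ^ 23 / (128 : ℝ) ^ d * Real.sqrt (ε / 2)) /
          (1600 * (#S' : ℝ))) * ρ₄ / 2 ≤ ρ₅) ∧
      (d : ℝ) ≤ (2 ^ 225 / ε ^ 168) ^ 17 ∧ S'.Nonempty ∧ (1 : ZMod M) ∈ S' ∧ 2 * c = 1 ∧
      0 < ρ₅ ∧ ρ₅ ≤ ρ₄ / (100 * (#S' : ℝ)) ∧ ρ₄ ≤ 1 / 8 ∧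
      (∀ r : ℝ, |r| ≤ 1 / (100 * (#S' : ℝ)) →
        (1 - 100 * (#S' : ℝ) * |r|) * #{x : ZMod M | ∀ ξ ∈ S', ‖ZMod.toAddCircle (x * ξ)‖ < ρ₅} ≤
            #{x : ZMod M | ∀ ξ ∈ S', ‖ZMod.toAddCircle (x * ξ)‖ < (1 + r) * ρ₅} ∧
          (#{x : ZMod M | ∀ ξ ∈ S', ‖ZMod.toAddCircle (x * ξ)‖ < (1 + r) * ρ₅} : ℝ) ≤
            (1 + 100 * (#S' : ℝ) * |r|) * #{x : ZMod M | ∀ ξ ∈ S', ‖ZMod.toAddCircle (x * ξ)‖ < ρ₅}) ∧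
      (∀ x ∈ ({v : ZMod M | ∀ ξ ∈ S', ‖ZMod.toAddCircle (v * ξ)‖ < ρ₄} : Finset (ZMod M)),
        ∀ h ∈ ({v : ZMod M | ∀ ξ ∈ S', ‖ZMod.toAddCircle (v * ξ)‖ < ρ₄} : Finset (ZMod M)),
          μ (x + h) = μ x + μ h) ∧
      x₀ ∈ ({v : ZMod M | ∀ ξ ∈ S', ‖ZMod.toAddCircle (v * ξ)‖ < ρ₄} : Finset (ZMod M)) ∧
      ε ^ 17 / 2 ^ 23 / (128 : ℝ) ^ d * Real.sqrt (ε / 2) / 16 *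
          #{x : ZMod M | ∀ ξ ∈ S', ‖ZMod.toAddCircle (x * ξ)‖ < ρ₅} ≤
        ‖∑ w ∈ ({x : ZMod M | ∀ ξ ∈ S', ‖ZMod.toAddCircle (x * ξ)‖ < ρ₅} : Finset (ZMod M)),
          ((f (w + t) : ℝ) : ℂ) * stdAddChar (c * μ (x₀ + w) * (x₀ + w)) * stdAddChar (w * ζ)‖ := by
  classical
  have hMpos : (0 : ℝ) < M := by exact_mod_cast Nat.pos_of_ne_zero (NeZero.ne M)
  have hodd : Odd M := hM.odd_of_ne_two (by omega)
  -- Step 1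
  obtain ⟨S, μ, d, ρ, β, x₀, ξ₀, hS, hd, hβlo, hβ1, hSβ, hρ1, hρ2, hreg, hadd, hbig⟩ :=
    exists_derivative_correlation_input hM hf hε0 hε
  have hρ0 : 0 < ρ := by linarith
  have hdS : (1 : ℝ) ≤ #S := by exact_mod_cast Nat.one_le_iff_ne_zero.mpr (card_pos.mpr hS).ne'
  -- the size of `S` from the spectral bound
  have hScard : (#S : ℝ) ≤ 1 + 4 / (ε ^ 17 / 2 ^ 23 / (128 : ℝ) ^ d) ^ 2 := by
    have hβ0 : 0 < ε ^ 17 / 2 ^ 23 / (128 : ℝ) ^ d := by positivity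
    have h4 : 0 ≤ 4 / (ε ^ 17 / 2 ^ 23 / (128 : ℝ) ^ d) ^ 2 := by positivity
    rcases hSβ with hS0 | hSβ'
    · rw [hS0, card_singleton]; push_cast; linarith
    · have hβpos : 0 < β := lt_of_lt_of_le hβ0 hβlo
      have h1 : (#S : ℝ) * β ^ 2 ≤ 4 := by
        have h1' : (#S : ℝ) * β ^ 2 * β ≤ 4 * β := by linarith
        exact le_of_mul_le_mul_right h1' hβpos
      have h2 : (#S : ℝ) ≤ 4 / β ^ 2 := by rw [le_div_iff₀ (pow_pos hβpos 2)]; exact h1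
      have h3 : 4 / β ^ 2 ≤ 4 / (ε ^ 17 / 2 ^ 23 / (128 : ℝ) ^ d) ^ 2 := by
        apply div_le_div_of_nonneg_left (by norm_num) (pow_pos hβ0 2)
        exact pow_le_pow_left₀ hβ0.le hβlo 2
      linarith
  -- the basic constant `κ`
  obtain ⟨κ, hκdef⟩ : ∃ κ : ℝ, κ = ε ^ 17 / 2 ^ 23 / (128 : ℝ) ^ d * Real.sqrt (ε / 2) := ⟨_, rfl⟩
  have hκ0 : 0 < κ := by rw [hκdef]; positivity
  have hκ1 : κ ≤ 1 := by
    rw [hκdef]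
    have h1 : ε ^ 17 ≤ 1 := pow_le_one₀ hε0.le hε1
    have h2 : Real.sqrt (ε / 2) ≤ 1 := by
      rw [Real.sqrt_le_one]; linarith
    have h3 : (1 : ℝ) ≤ (128 : ℝ) ^ d := one_le_pow₀ (by norm_num)
    have h4 : ε ^ 17 / 2 ^ 23 / (128 : ℝ) ^ d ≤ 1 := by
      rw [div_le_one (by positivity)]
      calc ε ^ 17 / 2 ^ 23 ≤ 1 / 2 ^ 23 := by gcongr
        _ ≤ 1 := by norm_num
        _ ≤ (128 : ℝ) ^ d := h3
    calc ε ^ 17 / 2 ^ 23 / (128 : ℝ) ^ d * Real.sqrt (ε / 2) ≤ 1 * 1 :=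
          mul_le_mul h4 h2 (Real.sqrt_nonneg _) zero_le_one
      _ = 1 := one_mul 1
  -- weights
  set c₂ : ZMod M → ℂ := fun v => ((f (v + x₀) : ℝ) : ℂ) with hc₂
  set c₃ : ZMod M → ℂ := fun x => ((f x : ℝ) : ℂ) * stdAddChar (-(x * ξ₀)) with hc₃
  have hc₂1 : ∀ v, ‖c₂ v‖ ≤ 1 := fun v => by
    rw [hc₂]; simp only; rw [Complex.norm_real, Real.norm_eq_abs]; exact hf _
  have hc₃1 : ∀ v, ‖c₃ v‖ ≤ 1 := fun v => by
    rw [hc₃]; simp only; rw [norm_mul, norm_stdAddChar, mul_one, Complex.norm_real,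
      Real.norm_eq_abs]; exact hf _
  have hbig' : κ * M * #{x : ZMod M | ∀ ξ ∈ S, ‖ZMod.toAddCircle (x * ξ)‖ < ρ} ≤
      ∑ h ∈ ({x : ZMod M | ∀ ξ ∈ S, ‖ZMod.toAddCircle (x * ξ)‖ < ρ} : Finset (ZMod M)),
        ‖∑ x : ZMod M, c₂ (x + h) * c₃ x * stdAddChar (-(μ h * x))‖ := by
    rw [hκdef]; exact hbig
  -- Step 2
  obtain ⟨ρ₂, ρ', F, hρ₂, hρ', hF, hsym⟩ :=
    exists_symmetric_halved_map S hS hρ0 hρ2 hκ0 hκ1 hreg hadd c₂ c₃ hc₂1 hc₃1 hbig'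
  have hρ₂0 : 0 < ρ₂ := lt_of_lt_of_le (by positivity) hρ₂
  have hρ'0 : 0 < ρ' := lt_of_lt_of_le (by positivity) hρ'
  -- Step 3: the halving constant
  obtain ⟨c, hcdef⟩ : ∃ c : ZMod M, c = (((M + 1) / 2 : ℕ) : ZMod M) := ⟨_, rfl⟩
  have hc : 2 * c = 1 := by rw [hcdef]; exact two_mul_half_eq_one hodd
  -- Step 3': the frequency set `S'` and the radius `ρ₄`
  obtain ⟨S', hS'def⟩ : ∃ S' : Finset (ZMod M), S' = S ∪ F ∪ S.image (fun ξ => c * ξ) ∪ {1} :=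
    ⟨_, rfl⟩
  have h1S' : (1 : ZMod M) ∈ S' := by rw [hS'def]; simp
  have hmemS' : ∀ {r : ℝ} {x : ZMod M},
      x ∈ ({y : ZMod M | ∀ ξ ∈ S', ‖ZMod.toAddCircle (y * ξ)‖ < r} : Finset (ZMod M)) →
      (∀ ξ ∈ S, ‖ZMod.toAddCircle (x * ξ)‖ < r) ∧ (∀ ζ ∈ F, ‖ZMod.toAddCircle (x * ζ)‖ < r) ∧
        (∀ ξ ∈ S, ‖ZMod.toAddCircle (x * (c * ξ))‖ < r) ∧ ‖ZMod.toAddCircle x‖ < r := by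
    intro r x hx
    rw [hS'def] at hx
    exact mem_bohr_union₄ S F c hx
  have hS'ne : S'.Nonempty := ⟨1, h1S'⟩
  have hdS' : (1 : ℝ) ≤ #S' := by exact_mod_cast Nat.one_le_iff_ne_zero.mpr (card_pos.mpr hS'ne).ne'
  obtain ⟨ε₁, hε₁⟩ : ∃ ε₁ : ℝ, ε₁ = min (1 / (100 * (#S : ℝ))) (κ / (400 * (#S : ℝ))) := ⟨_, rfl⟩
  have hSpos0 : (0 : ℝ) < #S := by linarith
  have hε₁0 : 0 < ε₁ := by
    rw [hε₁]
    exact lt_min (div_pos one_pos (mul_pos (by norm_num) hSpos0)) (div_pos hκ0 (mul_pos (by norm_num) hSpos0))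
  obtain ⟨m₄, hm₄⟩ : ∃ m₄ : ℝ, m₄ = min (1 / 12) (min ((κ ^ 4 / 8) ^ 8 / (2 ^ 32 * (#S : ℝ)) * ρ')
    (min (ε₁ * ρ) (κ * ρ₂ * (κ ^ 4 / 8) ^ 2 / (2 ^ 19 * Real.pi * (#S : ℝ))))) := ⟨_, rfl⟩
  have hSpos : (0 : ℝ) < #S := by linarith
  have hκ48 : 0 < κ ^ 4 / 8 := div_pos (pow_pos hκ0 4) (by norm_num)
  have hm₄0 : 0 < m₄ := by
    rw [hm₄]
    refine lt_min (by norm_num) (lt_min ?_ (lt_min (mul_pos hε₁0 hρ0) ?_))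
    · exact mul_pos (div_pos (pow_pos hκ48 8) (mul_pos (by norm_num) hSpos)) hρ'0
    · exact div_pos (mul_pos (mul_pos hκ0 hρ₂0) (pow_pos hκ48 2))
        (mul_pos (mul_pos (by norm_num) Real.pi_pos) hSpos)
  obtain ⟨ρ₄, hρ₄lo, hρ₄hi, hreg₄⟩ := exists_regular_bohr S' (ε := m₄ / 2) (by linarith)
  have hρ₄0 : 0 < ρ₄ := by linarith
  have hρ₄m : ρ₄ ≤ m₄ := by linarith
  rw [hm₄] at hρ₄m
  have hρ₄12 : ρ₄ ≤ 1 / 12 := hρ₄m.trans (min_le_left _ _)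
  have hρ₄8 : ρ₄ ≤ 1 / 8 := by linarith
  have hρ₄z : ρ₄ ≤ (κ ^ 4 / 8) ^ 8 / (2 ^ 32 * (#S : ℝ)) * ρ' :=
    hρ₄m.trans ((min_le_right _ _).trans (min_le_left _ _))
  have hρ₄ε : ρ₄ ≤ ε₁ * ρ :=
    hρ₄m.trans ((min_le_right _ _).trans ((min_le_right _ _).trans (min_le_left _ _)))
  have hρ₄θ : ρ₄ ≤ κ * ρ₂ * (κ ^ 4 / 8) ^ 2 / (2 ^ 19 * Real.pi * (#S : ℝ)) :=
    hρ₄m.trans ((min_le_right _ _).trans ((min_le_right _ _).trans (min_le_right _ _)))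
  -- the antisymmetry level `θ` and `2πθ ≤ κ/16`
  have hθκ : 2 * Real.pi * (4 * (2 ^ 12 * (#S : ℝ) * ρ₄ / (ρ₂ * (κ ^ 4 / 8) ^ 2))) ≤ κ / 16 :=
    theta_le_of_rho4_le hκ0 hρ₂0 hSpos hρ₄θ
  -- Step 4: descent, translates, phase replacement on `A = B(S',ρ₄)`
  have hA : ∀ a ∈ ({v : ZMod M | ∀ ξ ∈ S', ‖ZMod.toAddCircle (v * ξ)‖ < ρ₄} : Finset (ZMod M)),
      ∀ ξ ∈ S, ‖ZMod.toAddCircle (a * ξ)‖ ≤ ε₁ * ρ := by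
    intro a ha ξ hξ
    obtain ⟨haS, -, -, -⟩ := hmemS' ha
    exact (haS ξ hξ).le.trans hρ₄ε
  have hadd' : ∀ a ∈ ({v : ZMod M | ∀ ξ ∈ S', ‖ZMod.toAddCircle (v * ξ)‖ < ρ₄} : Finset (ZMod M)),
      ∀ h'' ∈ ({x : ZMod M | ∀ ξ ∈ S, ‖ZMod.toAddCircle (x * ξ)‖ < ρ} :
      Finset (ZMod M)), μ (a + h'') = μ a + μ h'' := by
    intro a ha h'' hh''
    obtain ⟨haS, -, -, -⟩ := hmemS' ha
    rw [mem_filter] at hh''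
    refine hadd a h'' (fun ξ hξ => (haS ξ hξ).le.trans (by linarith))
      (fun ξ hξ => (hh''.2 ξ hξ).le.trans (by linarith)) (fun ξ hξ => ?_)
    rw [add_mul, map_add]
    calc ‖ZMod.toAddCircle (a * ξ) + ZMod.toAddCircle (h'' * ξ)‖
        ≤ ‖ZMod.toAddCircle (a * ξ)‖ + ‖ZMod.toAddCircle (h'' * ξ)‖ := norm_add_le _ _
      _ ≤ ρ₄ + ρ := add_le_add (haS ξ hξ).le (hh''.2 ξ hξ).le
      _ ≤ 1 / 4 := by linarith
  have haddA : ∀ x ∈ ({v : ZMod M | ∀ ξ ∈ S', ‖ZMod.toAddCircle (v * ξ)‖ < ρ₄} : Finset (ZMod M)),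
      ∀ h ∈ ({v : ZMod M | ∀ ξ ∈ S', ‖ZMod.toAddCircle (v * ξ)‖ < ρ₄} : Finset (ZMod M)),
        μ (x + h) = μ x + μ h := by
    rw [hS'def]; exact small_bohr_additive S F c hρ₄8 hadd
  have hθA : ∀ x ∈ ({v : ZMod M | ∀ ξ ∈ S', ‖ZMod.toAddCircle (v * ξ)‖ < ρ₄} : Finset (ZMod M)),
      ∀ h ∈ ({v : ZMod M | ∀ ξ ∈ S', ‖ZMod.toAddCircle (v * ξ)‖ < ρ₄} : Finset (ZMod M)),
        ‖ZMod.toAddCircle (c * μ x * h - c * μ h * x)‖ ≤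
          4 * (2 ^ 12 * (#S : ℝ) * ρ₄ / (ρ₂ * (κ ^ 4 / 8) ^ 2)) := by
    rw [hS'def]; exact small_bohr_antisym_le S F hc hρ₄0 hρ₄8 hρ₄z hρ₄12 hsym
  have hε₁100 : ε₁ ≤ 1 / (100 * (#S : ℝ)) := by rw [hε₁]; exact min_le_left _ _
  have hκε₁ : 200 * (#S : ℝ) * ε₁ ≤ κ / 2 :=
    eps1_bound hSpos (by rw [hε₁]; exact min_le_right _ _)
  obtain ⟨h', hh', b, hb, hfam⟩ := exists_phase_replaced_family S hS hρ0 hε₁0 hε₁100 hκε₁ hreg hA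
    hadd' haddA hc hθA c₂ c₃ hc₂1 hc₃1 hbig'
  -- Step 5: localisation, `fgh`, choice of `y`
  obtain ⟨ε₅, hε₅⟩ : ∃ ε₅ : ℝ, ε₅ = min (1 / (100 * (#S' : ℝ))) (κ / (1600 * (#S' : ℝ))) := ⟨_, rfl⟩
  have hS'pos : (0 : ℝ) < #S' := by linarith
  have hε₅0 : 0 < ε₅ := by
    rw [hε₅]
    exact lt_min (div_pos one_pos (mul_pos (by norm_num) hS'pos)) (div_pos hκ0 (mul_pos (by norm_num) hS'pos))
  have hε₅100 : ε₅ ≤ 1 / (100 * (#S' : ℝ)) := by rw [hε₅]; exact min_le_left _ _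
  obtain ⟨ρ₅, hρ₅lo, hρ₅hi, hreg₅⟩ := exists_regular_bohr S' (ε := ε₅ * ρ₄ / 2)
    (by linarith [mul_pos hε₅0 hρ₄0])
  have hρ₅0 : 0 < ρ₅ := lt_of_lt_of_le (by linarith [mul_pos hε₅0 hρ₄0]) hρ₅lo
  have hρ₅ε : ρ₅ ≤ ε₅ * ρ₄ := by linarith
  have hK : κ / 4 * M *
      (#({v : ZMod M | ∀ ξ ∈ S', ‖ZMod.toAddCircle (v * ξ)‖ < ρ₄} : Finset (ZMod M)) : ℝ) ^ 2 ≤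
      ∑ y : ZMod M, ‖∑ h ∈ ({v : ZMod M | ∀ ξ ∈ S', ‖ZMod.toAddCircle (v * ξ)‖ < ρ₄} : Finset (ZMod M)),
        (fun y h => b y h * stdAddChar (c * μ h * h)) y h *
        ∑ x ∈ ({v : ZMod M | ∀ ξ ∈ S', ‖ZMod.toAddCircle (v * ξ)‖ < ρ₄} : Finset (ZMod M)),
          (fun y h x => (c₂ (x + y + h + h') *
          conj (ZMod.stdAddChar (c * μ (x + h) * (x + h)) : ℂ)) *
            ((c₃ (x + y) * stdAddChar (-(μ h' * (x + y)))) * stdAddChar (c * μ x * x))) y h x‖ := by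
    refine le_trans ?_ hfam
    have hA2 : (0 : ℝ) ≤ M *
        (#({v : ZMod M | ∀ ξ ∈ S', ‖ZMod.toAddCircle (v * ξ)‖ < ρ₄} : Finset (ZMod M)) : ℝ) ^ 2 :=
      mul_nonneg hMpos.le (sq_nonneg _)
    have h3 := mul_le_mul_of_nonneg_right hθκ hA2
    have e1 : ∀ t : ℝ, t * (M : ℝ) *
        (#({v : ZMod M | ∀ ξ ∈ S', ‖ZMod.toAddCircle (v * ξ)‖ < ρ₄} : Finset (ZMod M)) : ℝ) ^ 2 =
        t * ((M : ℝ) *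
        (#({v : ZMod M | ∀ ξ ∈ S', ‖ZMod.toAddCircle (v * ξ)‖ < ρ₄} : Finset (ZMod M)) : ℝ) ^ 2) :=
      fun t => by ring
    have h4 : 0 ≤ κ * ((M : ℝ) *
        (#({v : ZMod M | ∀ ξ ∈ S', ‖ZMod.toAddCircle (v * ξ)‖ < ρ₄} : Finset (ZMod M)) : ℝ) ^ 2) :=
      mul_nonneg hκ0.le hA2
    rw [e1, e1, e1]
    linarith
  obtain ⟨x₁, hx₁, y, ξ, hcorr⟩ := exists_localised_linear_correlation S' hS'ne hρ₄0 hρ₅0 hρ₅ε hε₅0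
    hε₅100 _ _ rfl rfl hreg₄
    (fun y h x => (c₂ (x + y + h + h') * conj (ZMod.stdAddChar (c * μ (x + h) * (x + h)) : ℂ)) *
      ((c₃ (x + y) * stdAddChar (-(μ h' * (x + y)))) * stdAddChar (c * μ x * x)))
    (fun y h x => norm_kernel_le_one c₂ c₃ hc₂1 hc₃1 c h' μ y h x)
    (fun y h => b y h * stdAddChar (c * μ h * h)) (fun y h => norm_kernelWeight_le_one b hb c μ y h)
    (fun x₀' y w => (c₃ (x₀' + w + y) * stdAddChar (-(μ h' * (x₀' + w + y)))) *
      stdAddChar (c * μ (x₀' + w) * (x₀' + w)))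
    (fun x₀' y v => c₂ (x₀' + v + y + h') * conj (ZMod.stdAddChar (c * μ (x₀' + v) * (x₀' + v)) : ℂ))
    (fun x₀' y v => norm_kernelPsi_le_one c₂ hc₂1 c h' μ x₀' y v)
    (fun x₀' y h w => kernel_factorises c₂ c₃ c h' μ x₀' y h w) hK
  -- Step 6: conclusion
  refine ⟨d, S, F, S', c, μ, ρ, ρ₂, ρ', ρ₄, ρ₅, x₁, x₁ + y, ξ - ξ₀ - μ h',
    ⟨hS'def, hS, hScard, ?_, hρ1, hρ2, ?_, ?_, ?_, ?_⟩,
    hd, hS'ne, h1S', hc, hρ₅0, ?_, hρ₄8, hreg₅, haddA, hx₁, ?_⟩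
  · rw [hκdef] at hF; exact hF
  · rw [hκdef] at hρ₂; exact hρ₂
  · rw [hκdef] at hρ'; exact hρ'
  · rw [hκdef] at hε₁; rw [hε₁, hκdef] at hm₄; rw [← hm₄]; exact hρ₄lo
  · rw [hκdef] at hε₅; rw [← hε₅]; exact hρ₅lo
  · calc ρ₅ ≤ ε₅ * ρ₄ := hρ₅ε
      _ ≤ 1 / (100 * (#S' : ℝ)) * ρ₄ := mul_le_mul_of_nonneg_right hε₅100 hρ₄0.le
      _ = ρ₄ / (100 * (#S' : ℝ)) := by ring
  · have hconst : κ / 16 ≤ (κ / 4 - 200 * (#S' : ℝ) * ε₅) / 2 :=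
      eps5_bound hS'pos (by rw [hε₅]; exact min_le_right _ _)
    have hB₅0 : (0 : ℝ) ≤
        #({v : ZMod M | ∀ ξ ∈ S', ‖ZMod.toAddCircle (v * ξ)‖ < ρ₅} : Finset (ZMod M)) :=
      Nat.cast_nonneg _
    have hfin := norm_local_sum_eq
      ({v : ZMod M | ∀ ξ ∈ S', ‖ZMod.toAddCircle (v * ξ)‖ < ρ₅} : Finset (ZMod M)) f c h' ξ₀ ξ μ x₁ y
    have e : ε ^ 17 / 2 ^ 23 / (128 : ℝ) ^ d * Real.sqrt (ε / 2) / 16 = κ / 16 := by rw [hκdef]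
    rw [e]
    calc κ / 16 * (#({v : ZMod M | ∀ ξ ∈ S', ‖ZMod.toAddCircle (v * ξ)‖ < ρ₅} : Finset (ZMod M)) : ℝ)
        ≤ (κ / 4 - 200 * (#S' : ℝ) * ε₅) / 2 *
          #({v : ZMod M | ∀ ξ ∈ S', ‖ZMod.toAddCircle (v * ξ)‖ < ρ₅} : Finset (ZMod M)) :=
          mul_le_mul_of_nonneg_right hconst hB₅0
      _ = (κ / 4 - 200 * (#S' : ℝ) * ε₅) *
          #({v : ZMod M | ∀ ξ ∈ S', ‖ZMod.toAddCircle (v * ξ)‖ < ρ₅} : Finset (ZMod M)) / 2 := by ring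
      _ ≤ _ := hcorr
      _ = _ := by rw [hc₃]; exact hfin

end Summit.Parity.GeneralizedHardyLittlewood.GreenTaoLevelTwoGITwoCyclicInverse
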